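import Summits.CriticalPhenomena.PercolationContinuityZ3.Theorems.PercNearOneGluingNoHeavyLowerTailRefinedRowR2FourFunctions
import Literature.Probability.LatticeModels.RandomClusterEdgeWeights
import Mathlib.Combinatorics.SetFamily.FourFunctions
import Mathlib.Tactic.Linarith
import HarnessLib

/-!
# `NoHeavyLowerTail` (stmt-CriticalPhenomena-4575) — THEOREM R2 `s_a · u_a ≤ b₀ · t` holds for EVERY weight with
# the FKG lattice condition, in particular for the random-cluster measures `φ_{𝐩,q}`, all `q ≥ 1`

Support file (prover prim-gen-kcluster gen 50; `--supports stmt-CriticalPhenomena-4575`).  No named facts, no sorries, no definitions.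

KCLUSTER-gen46 §3.3 (run/shared/lean/prim/prim-gen-kcluster/) recorded the four refined quadratic S-side rows R1, R2, R3, R4⁺ as
"KERNEL at `q = 1`, census-true (0 / 171 471 per row per cluster weight) for the random-cluster measure on both sides of `q = 1`;
the `q ≠ 1` cases are NOT explained by the kernel proofs".  For R2 they are, on the FKG side: the kernel proof of R2
(`RefinedRowR2.r2_PrW`, gen 35) is the Ahlswede–Daykin four functions theorem applied to the POINTWISE lattice lemma
`RefinedRowR2.pointwise_R2` (`ω ∈ S_a`, `ω′ ∈ U_a` ⇒ `ω ∩ ω′ ∈ B_0`, `ω ∪ ω′ ∈ T`), and the four functions theorem needs only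
the lattice condition `μ(ω) μ(ω′) ≤ μ(ω ∩ ω′) μ(ω ∪ ω′)` of the weight, not its product structure.  Hence:

* `fourEvents_of_latticeCondition` — four events for an arbitrary weight `μ ≥ 0` on the configurations `S ⊆ D` with the FKG
  lattice condition (Mathlib's `Finset.four_functions_theorem` with `fᵢ = 1_{Aᵢ} μ`).  [cite: AhlswedeDaykin1978, Theorem 1]
* **`r2_of_latticeCondition`** — R2 `μ(S_a) · μ(U_a) ≤ μ(B_0) · μ(T)` for every such `μ` (support `D` joining the terminals):
  R2 is an FKG-LATTICE row (like Gladkov's `AG ≥ 0`, tree `LatticeKernel.*`, and unlike R1/R3, which fail for generic lattice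
  weights — KCLUSTER-gen33 §6 (223/680) / gen46 §3.4).
* `rcMeasureW_fourEvents` — four events for the edge-parameter random-cluster measure `rcMeasureW w q B`, `q ≥ 1`, any wired set
  `B`, in SUPPORT form: the lattice implication is required only for configurations inside a set `E` off which the parameters
  vanish (configurations meeting `Eᶜ` have weight `0`, `rcWeightW_eq_zero_of_mem`); the lattice condition is the tree's
  `rcWeightW_lattice_condition` (Grimmett 2006 Thm. (3.8)).  The homogeneous `rcMeasure G p q B` version is the tree's
  `rcMeasure_real_four_events`.  [cite: Grimmett2006, Thm. (3.8) eq. (3.11); AhlswedeDaykin1978, Theorem 1]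
* **`r2_rcMeasureW`** — R2 for `φ = rcMeasureW w q B`, EVERY `q ≥ 1`, every wired set `B`, every `w` supported on a pair set `D`
  joining the terminals: `φ{ω | ω ∈ S_a} · φ{ω | ω ∈ U_a} ≤ φ{ω | ω ∈ B_0} · φ{ω | ω ∈ T}`, the cells being those of
  `…RefinedRowR3Switching` / `…RefinedRowR2FourFunctions` read on `ω.toFinset` (dictionary `toFinset_mem_cellT_iff`,
  `toFinset_mem_cellUa_iff`, `toFinset_mem_apart_iff`, `sep_iff_not_openConn` in the `openConn` vocabulary);
  `r2_prodBernoulli` — the `q = 1` case read back on `prodBernoulli w` (`rcMeasureW_one`), i.e. the measure form of `r2_PrW`.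
So in the q-deformation table R2 moves from "q-universal (census)" to KERNEL for every `q ≥ 1` (and for every FKG edge law);
its `q < 1` half stays census-only (there the lattice condition fails).
-/

noncomputable section

namespace Summit.CriticalPhenomena.PercolationContinuityZ3.Theorems

namespace RefinedRowR2

open Finset Literature.Probability.Percolation Literature.Probability.Percolation.DecisionTree
open Literature.Probability.Percolation.Gladkov ThreePointLB RefinedRowR3
open Literature.Probability.LatticeModels MeasureTheory
open scoped Classical FinsetFamily

/-! ### Four events for a weight with the FKG lattice condition -/

section Lattice

variable {ι : Type*} [DecidableEq ι]

/-- **Four events for an FKG-lattice weight** (Ahlswede–Daykin on the weighted cube `D.powerset`): if `μ ≥ 0` satisfies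
`μ S · μ T ≤ μ (S ∩ T) · μ (S ∪ T)` for `S, T ⊆ D`, and `S ∈ A₁`, `T ∈ A₂` (`S, T ⊆ D`) force `S ∩ T ∈ A₃` and `S ∪ T ∈ A₄`,
then `μ(A₁) · μ(A₂) ≤ μ(A₃) · μ(A₄)` for the masses `μ(A) = Σ_{S ⊆ D, S ∈ A} μ S`.
[cite: AhlswedeDaykin1978, Theorem 1] -/
theorem fourEvents_of_latticeCondition (D : Finset ι) {μ : Finset ι → ℝ} (hμ0 : ∀ S, 0 ≤ μ S)
    (hμ : ∀ ⦃S⦄, S ⊆ D → ∀ ⦃T⦄, T ⊆ D → μ S * μ T ≤ μ (S ∩ T) * μ (S ∪ T))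
    (A₁ A₂ A₃ A₄ : Set (Finset ι))
    (h : ∀ S, S ⊆ D → ∀ T, T ⊆ D → S ∈ A₁ → T ∈ A₂ → S ∩ T ∈ A₃ ∧ S ∪ T ∈ A₄) :
    (∑ S ∈ D.powerset, A₁.indicator μ S) * (∑ S ∈ D.powerset, A₂.indicator μ S) ≤
      (∑ S ∈ D.powerset, A₃.indicator μ S) * (∑ S ∈ D.powerset, A₄.indicator μ S) := by
  have hnn : ∀ (A : Set (Finset ι)), 0 ≤ A.indicator μ := fun A S =>
    Set.indicator_nonneg (fun T _ => hμ0 T) S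
  have key := Finset.four_functions_theorem D (f₁ := A₁.indicator μ) (f₂ := A₂.indicator μ)
    (f₃ := A₃.indicator μ) (f₄ := A₄.indicator μ) (hnn A₁) (hnn A₂) (hnn A₃) (hnn A₄) ?_
    (𝒜 := D.powerset) (ℬ := D.powerset) subset_rfl subset_rfl
  · simp only [powerset_infs_powerset_self, powerset_sups_powerset_self] at key
    exact key
  intro S hS T hT
  by_cases h1 : S ∈ A₁
  · by_cases h2 : T ∈ A₂
    · obtain ⟨h3, h4⟩ := h S hS T hT h1 h2
      rw [Set.indicator_of_mem h1, Set.indicator_of_mem h2, Set.indicator_of_mem h3, Set.indicator_of_mem h4]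
      exact hμ hS hT
    · rw [Set.indicator_of_notMem h2, mul_zero]
      exact mul_nonneg (hnn A₃ _) (hnn A₄ _)
  · rw [Set.indicator_of_notMem h1, zero_mul]
    exact mul_nonneg (hnn A₃ _) (hnn A₄ _)

end Lattice

/-! ### THEOREM R2 for every FKG-lattice weight -/

section R2Lattice

variable {V : Type*} [Fintype V] [DecidableEq V]

/-- **THEOREM R2 for every FKG-lattice weight** (`s_a · u_a ≤ b₀ · t`): for `μ ≥ 0` on the configurations `S ⊆ D`
with the lattice condition `μ S · μ T ≤ μ (S ∩ T) · μ (S ∪ T)`, and a support `D` joining the terminals,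
`μ(S_a) · μ(U_a) ≤ μ(B_0) · μ(T)` — four events (`fourEvents_of_latticeCondition`) and the pointwise lattice lemma
`pointwise_R2`.  The product weight (`r2_PrW`) is the log-modular special case. [this work] -/
theorem r2_of_latticeCondition (D : Finset (Sym2 V)) {μ : Finset (Sym2 V) → ℝ} (hμ0 : ∀ S, 0 ≤ μ S)
    (hμ : ∀ ⦃S⦄, S ⊆ D → ∀ ⦃T⦄, T ⊆ D → μ S * μ T ≤ μ (S ∩ T) * μ (S ∪ T))
    {a b c : V} (hDb : b ∈ cl D a) (hDc : c ∈ cl D a) :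
    (∑ S ∈ D.powerset, (cellSa D a b c).indicator μ S) * (∑ S ∈ D.powerset, (cellUa a b c).indicator μ S) ≤
      (∑ S ∈ D.powerset, (cellB0 D a b c).indicator μ S) * (∑ S ∈ D.powerset, (cellT a b c).indicator μ S) :=
  fourEvents_of_latticeCondition D hμ0 hμ _ _ _ _ fun _ hS _ hT h1 h2 => pointwise_R2 hS hT hDb hDc h1 h2

end R2Lattice

/-! ### Four events for the random-cluster measure `φ_{𝐩,q}`, `q ≥ 1` (support form) -/

section RandomCluster

variable {V : Type*} [Fintype V]

/-- An open pair of parameter `0` kills the random-cluster weight: `e ∈ ω`, `w e = 0` ⇒ `rcWeightW w q B ω = 0`.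
[cite: Grimmett2006, §1.4 eq. (1.20) (p. 15)] -/
theorem rcWeightW_eq_zero_of_mem (w : Sym2 V → unitInterval) (q : ℝ) (B : Set V) {ω : BondConfig V}
    {e : Sym2 V} (he : e ∈ ω) (hwe : w e = 0) : rcWeightW w q B ω = 0 := by
  unfold rcWeightW BHK2006.weight
  rw [Finset.prod_eq_zero (Finset.mem_univ e) ?_, zero_mul]
  rw [if_pos he]
  show ((w e : ℝ)) = 0
  rw [hwe]
  rfl

/-- **Four events for `φ^B_{𝐩,q}`, `q ≥ 1`, support form.**  Let the parameters `w` vanish off `E ⊆ Sym2 V`.  If for all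
configurations `ω, ω′ ⊆ E` membership `ω ∈ A₁`, `ω′ ∈ A₂` forces `ω ∩ ω′ ∈ A₃` and `ω ∪ ω′ ∈ A₄`, then
`φ(A₁) φ(A₂) ≤ φ(A₃) φ(A₄)` for `φ = rcMeasureW w q B` — the four functions theorem for the log-supermodular weight
`(∏ w_e^{ω(e)} (1-w_e)^{1-ω(e)}) q^{k^B(ω)}` (`rcWeightW_lattice_condition`); configurations meeting `Eᶜ` weigh `0`.
(Homogeneous version in the tree: `rcMeasure_real_four_events`.)
[cite: Grimmett2006, Thm. (3.8) eq. (3.11); AhlswedeDaykin1978, Theorem 1] -/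
theorem rcMeasureW_fourEvents (w : Sym2 V → unitInterval) {q : ℝ} (hq : 1 ≤ q) (B : Set V)
    (E : Set (Sym2 V)) (hw : ∀ e, e ∉ E → w e = 0) {A₁ A₂ A₃ A₄ : Set (BondConfig V)}
    (h : ∀ ⦃ω : BondConfig V⦄, ω ⊆ E → ∀ ⦃ω' : BondConfig V⦄, ω' ⊆ E →
      ω ∈ A₁ → ω' ∈ A₂ → ω ∩ ω' ∈ A₃ ∧ ω ∪ ω' ∈ A₄) :
    (rcMeasureW w q B).real A₁ * (rcMeasureW w q B).real A₂ ≤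
      (rcMeasureW w q B).real A₃ * (rcMeasureW w q B).real A₄ := by
  have hq0 : 0 < q := one_pos.trans_le hq
  have hZ := rcPartitionFunctionW_pos w hq0 B
  set μ : BondConfig V → ℝ := rcWeightW w q B with hμ
  have hμ0 : ∀ ω, 0 ≤ μ ω := fun ω => rcWeightW_nonneg w hq0.le B ω
  have hsupp : ∀ ω : BondConfig V, ¬ ω ⊆ E → μ ω = 0 := by
    intro ω hω
    obtain ⟨e, heω, heE⟩ := Set.not_subset.1 hω
    exact rcWeightW_eq_zero_of_mem w q B heω (hw e heE)
  have hnn : ∀ A : Set (BondConfig V), (0 : BondConfig V → ℝ) ≤ fun ω => μ ω * ind A ω := fun A ω =>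
    mul_nonneg (hμ0 ω) (ind_nonneg A ω)
  have key := four_functions_theorem_univ (f₁ := fun ω => μ ω * ind A₁ ω) (f₂ := fun ω => μ ω * ind A₂ ω)
    (f₃ := fun ω => μ ω * ind A₃ ω) (f₄ := fun ω => μ ω * ind A₄ ω) (hnn A₁) (hnn A₂) (hnn A₃) (hnn A₄) ?_
  · rw [rcMeasureW_real_eq_sum_div w hq0 B A₁, rcMeasureW_real_eq_sum_div w hq0 B A₂,
      rcMeasureW_real_eq_sum_div w hq0 B A₃, rcMeasureW_real_eq_sum_div w hq0 B A₄,
      div_mul_div_comm, div_mul_div_comm]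
    exact div_le_div_of_nonneg_right key (mul_pos hZ hZ).le
  intro ω ω'
  change μ ω * ind A₁ ω * (μ ω' * ind A₂ ω') ≤
    μ (ω ∩ ω') * ind A₃ (ω ∩ ω') * (μ (ω ∪ ω') * ind A₄ (ω ∪ ω'))
  have hR : 0 ≤ μ (ω ∩ ω') * ind A₃ (ω ∩ ω') * (μ (ω ∪ ω') * ind A₄ (ω ∪ ω')) :=
    mul_nonneg (hnn A₃ _) (hnn A₄ _)
  by_cases hωE : ω ⊆ E
  swap
  · rw [hsupp ω hωE, zero_mul, zero_mul]; exact hR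
  by_cases hω'E : ω' ⊆ E
  swap
  · rw [hsupp ω' hω'E, zero_mul, mul_zero]; exact hR
  by_cases h1 : ω ∈ A₁
  swap
  · rw [ind_of_not_mem h1, mul_zero, zero_mul]; exact hR
  by_cases h2 : ω' ∈ A₂
  swap
  · rw [ind_of_not_mem h2, mul_zero, mul_zero]; exact hR
  obtain ⟨h3, h4⟩ := h hωE hω'E h1 h2
  rw [ind_of_mem h1, ind_of_mem h2, ind_of_mem h3, ind_of_mem h4, mul_one, mul_one, mul_one, mul_one]
  exact rcWeightW_lattice_condition w hq B ω ω'

end RandomCluster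

/-! ### Dictionary: the refined cells read on `ω.toFinset` in the `openConn` vocabulary -/

section Dictionary

variable {V : Type*} [Fintype V] [DecidableEq V]

omit [DecidableEq V] in
/-- `ω.toFinset ∈ T ⟺ a ↔ b and a ↔ c`. [this work] -/
theorem toFinset_mem_cellT_iff (ω : BondConfig V) (a b c : V) :
    ω.toFinset ∈ cellT a b c ↔ ω ∈ openConn a b ∧ ω ∈ openConn a c := by
  simp only [mem_cellT, mem_cl, Set.coe_toFinset]
  rfl

omit [DecidableEq V] in
/-- `ω.toFinset ∈ apart a b c ⟺ a ↮ b, a ↮ c, b ↮ c`. [this work] -/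
theorem toFinset_mem_apart_iff (ω : BondConfig V) (a b c : V) :
    ω.toFinset ∈ apart a b c ↔ ω ∉ openConn a b ∧ ω ∉ openConn a c ∧ ω ∉ openConn b c := by
  simp only [mem_apart, mem_cl, Set.coe_toFinset]
  rfl

omit [DecidableEq V] in
/-- `ω.toFinset ∈ U_a ⟺ a ↮ b, a ↮ c, b ↔ c`. [this work] -/
theorem toFinset_mem_cellUa_iff (ω : BondConfig V) (a b c : V) :
    ω.toFinset ∈ cellUa a b c ↔ ω ∉ openConn a b ∧ ω ∉ openConn a c ∧ ω ∈ openConn b c := by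
  simp only [mem_cellUa, mem_cl, Set.coe_toFinset]
  rfl

/-- Support separation in the `openConn` vocabulary: `Sep D W u v` iff `u ↮ v` in the configuration consisting of the
support pairs that avoid `W`. [this work] -/
theorem sep_iff_not_openConn (D : Finset (Sym2 V)) (W : Finset V) (u v : V) :
    RefinedRowR3.Sep D W u v ↔ ((↑D : Set (Sym2 V)) \ {e | ∃ x ∈ W, x ∈ e}) ∉ openConn u v := by
  have hcoe : (↑(D \ touch W) : Set (Sym2 V)) = (↑D : Set (Sym2 V)) \ {e | ∃ x ∈ W, x ∈ e} := by
    ext e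
    simp only [Finset.coe_sdiff, Set.mem_sdiff, Finset.mem_coe, mem_touch, Set.mem_setOf_eq]
  unfold RefinedRowR3.Sep
  rw [mem_cl, hcoe]
  rfl

omit [DecidableEq V] in
/-- The cluster of `a` read on `ω.toFinset` is the open cluster: `v ∈ cl ω.toFinset a ⟺ a ↔ v`. [this work] -/
theorem mem_cl_toFinset_iff (ω : BondConfig V) (a v : V) : v ∈ cl ω.toFinset a ↔ ω ∈ openConn a v := by
  rw [mem_cl, Set.coe_toFinset]
  rfl

end Dictionary

/-! ### THEOREM R2 for `φ_{𝐩,q}`, every `q ≥ 1` -/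

section R2RandomCluster

variable {V : Type*} [Fintype V] [DecidableEq V]

/-- **THEOREM R2 for the random-cluster measure, every `q ≥ 1`** (`s_a · u_a ≤ b₀ · t`): for parameters `w` supported on
a pair set `D` whose graph joins `b` and `c` to `a`, every cluster weight `q ≥ 1` and every wired set `B`, with
`φ = rcMeasureW w q B` and the refined cells of `…RefinedRowR3Switching` read on `ω.toFinset`
(`S_a`: `a|b|c` and the cluster of `a` meets every `b–c` path of `D`; `U_a`: `a|bc`; `B_0`: `a|b|c` and no terminal's
cluster separates the other two in `D`; `T`: `abc`):
`φ(S_a) · φ(U_a) ≤ φ(B_0) · φ(T)`.  PROOF: `rcMeasureW_fourEvents` on `E = D` and `pointwise_R2`. [this work] -/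
theorem r2_rcMeasureW (D : Finset (Sym2 V)) (w : Sym2 V → unitInterval) (hw : ∀ e, e ∉ D → w e = 0)
    {q : ℝ} (hq : 1 ≤ q) (B : Set V) {a b c : V} (hDb : b ∈ cl D a) (hDc : c ∈ cl D a) :
    (rcMeasureW w q B).real {ω : BondConfig V | ω.toFinset ∈ cellSa D a b c} *
        (rcMeasureW w q B).real {ω : BondConfig V | ω.toFinset ∈ cellUa a b c} ≤
      (rcMeasureW w q B).real {ω : BondConfig V | ω.toFinset ∈ cellB0 D a b c} *
        (rcMeasureW w q B).real {ω : BondConfig V | ω.toFinset ∈ cellT a b c} := by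
  refine rcMeasureW_fourEvents w hq B (↑D : Set (Sym2 V)) (fun e he => hw e (by exact_mod_cast he)) ?_
  intro ω hω ω' hω' h1 h2
  have hX : ω.toFinset ⊆ D := Set.toFinset_subset.2 hω
  have hY : ω'.toFinset ⊆ D := Set.toFinset_subset.2 hω'
  obtain ⟨h3, h4⟩ := pointwise_R2 hX hY hDb hDc h1 h2
  refine ⟨?_, ?_⟩
  · simp only [Set.mem_setOf_eq, Set.toFinset_inter]
    convert h3 using 2
  · simp only [Set.mem_setOf_eq, Set.toFinset_union]
    convert h4 using 2

/-- **THEOREM R2, measure form at `q = 1`** (product measure `prodBernoulli w`, `w` supported on `D` joining the terminals):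
`P(S_a) · P(U_a) ≤ P(B_0) · P(T)` — `r2_rcMeasureW` at `q = 1` and `rcMeasureW_one`; the measure reading of `r2_PrW`.
[this work] -/
theorem r2_prodBernoulli (D : Finset (Sym2 V)) (w : Sym2 V → unitInterval) (hw : ∀ e, e ∉ D → w e = 0)
    {a b c : V} (hDb : b ∈ cl D a) (hDc : c ∈ cl D a) :
    (prodBernoulli w).real {ω : BondConfig V | ω.toFinset ∈ cellSa D a b c} *
        (prodBernoulli w).real {ω : BondConfig V | ω.toFinset ∈ cellUa a b c} ≤
      (prodBernoulli w).real {ω : BondConfig V | ω.toFinset ∈ cellB0 D a b c} *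
        (prodBernoulli w).real {ω : BondConfig V | ω.toFinset ∈ cellT a b c} := by
  have h := r2_rcMeasureW D w hw le_rfl (∅ : Set V) hDb hDc
  rwa [rcMeasureW_one] at h

end R2RandomCluster

end RefinedRowR2

end Summit.CriticalPhenomena.PercolationContinuityZ3.Theorems

end
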